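import Mathlib
/-! # Stub `stub_powerSumCriterion` — crux `TwoProducts` (stmt-ValiantsHypothesis-5906), line `corner-log-linearization`
   Power-sum criterion (log-linearisation at finite order): for `P = ∏ u_i`, `Q = ∏ v_i` with
   constant terms `1`, an additive weight `ω ≥ 1` on nonzero exponents, and `ω e < R`: `e` is the
   unique `ω`-lightest support point of `P - Q` iff it is so for the order-`R` truncation
   `Λ_R = ∑_{r=1}^{R} ((-1)^(r+1)/r) • (∑_i (u_i-1)^r - ∑_i (v_i-1)^r)` of `∑ log u_i - ∑ log v_i`.
   Purely polynomial proof via an Euler derivation `D` (`coeff q (D A) = ω q * coeff q A`):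
   `D (log_R u) = D u * ∑_{t<R} (1-u)^t`, `u * ∑_{t<R} (1-u)^t = 1 - (1-u)^R ≡ 1` below weight `R`,
   hence `D (P-Q) * Q - (P-Q) * D Q ≡ P * Q * D Λ_R` below `R`; lowest-term transfer lemmas
   then carry "unique lightest support point" along the chain. [folklore] -/
set_option linter.dupNamespace false -- single-conjunct summit: `ValiantsHypothesis.ValiantsHypothesis`
namespace Summit.ValiantsHypothesis.ValiantsHypothesis.Theorems.TwoProducts.PowerSum
open scoped BigOperators
open MvPolynomial

/-- An additive weight vanishes at the zero exponent. [folklore] -/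
theorem wt_zero (ω : (Fin 2 →₀ ℕ) → ℤ) (hadd : ∀ p q, ω (p + q) = ω p + ω q) : ω 0 = 0 := by
  linarith [hadd 0 0, congrArg ω (add_zero (0 : Fin 2 →₀ ℕ))]

/-- An additive weight that is `≥ 1` on nonzero exponents is nonnegative. [folklore] -/
theorem wt_nonneg (ω : (Fin 2 →₀ ℕ) → ℤ) (hadd : ∀ p q, ω (p + q) = ω p + ω q)
    (hpos : ∀ p, p ≠ 0 → 1 ≤ ω p) (p : Fin 2 →₀ ℕ) : 0 ≤ ω p := by
  by_cases hp : p = 0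
  · rw [hp, wt_zero ω hadd]
  · linarith [hpos p hp]

/-- Congruence of coefficients below a weight bound is preserved by products. [folklore] -/
theorem coeff_mul_congr_below (ω : (Fin 2 →₀ ℕ) → ℤ) (hadd : ∀ p q, ω (p + q) = ω p + ω q)
    (hpos : ∀ p, p ≠ 0 → 1 ≤ ω p) (N : ℤ) (A A' B B' : MvPolynomial (Fin 2) ℂ)
    (hA : ∀ p, ω p < N → coeff p A = coeff p A') (hB : ∀ p, ω p < N → coeff p B = coeff p B') :
    ∀ p, ω p < N → coeff p (A * B) = coeff p (A' * B') := by
  intro p hp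
  rw [coeff_mul, coeff_mul]
  refine Finset.sum_congr rfl fun x hx => ?_
  rw [Finset.HasAntidiagonal.mem_antidiagonal] at hx
  have h1 := wt_nonneg ω hadd hpos x.1
  have h2 := wt_nonneg ω hadd hpos x.2
  rw [← hx, hadd] at hp
  rw [hA x.1 (by linarith), hB x.2 (by linarith)]

/-- Support points of `h ^ s`, `h` constant-free, weigh at least `s`. [folklore] -/
theorem le_wt_of_mem_support_pow (ω : (Fin 2 →₀ ℕ) → ℤ) (hadd : ∀ p q, ω (p + q) = ω p + ω q)
    (hpos : ∀ p, p ≠ 0 → 1 ≤ ω p) (h : MvPolynomial (Fin 2) ℂ) (h0 : coeff 0 h = 0) :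
    ∀ (s : ℕ) (p : Fin 2 →₀ ℕ), p ∈ (h ^ s).support → (s : ℤ) ≤ ω p := by
  intro s
  induction s with
  | zero =>
    intro p hp
    rw [pow_zero, mem_support_iff, coeff_one] at hp
    split_ifs at hp with h'
    · simp [← h', wt_zero ω hadd]
    · exact absurd rfl hp
  | succ s ih =>
    intro p hp
    obtain ⟨a, ha, b, hb, rfl⟩ := Finset.mem_add.mp (support_mul _ _ (pow_succ h s ▸ hp))
    have hb0 : b ≠ 0 := by rintro rfl; exact (mem_support_iff.mp hb) h0
    rw [hadd]
    push_cast
    linarith [ih a ha, hpos b hb0]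

/-- `h ^ R`, `h` constant-free, has no coefficients of weight `< R`. [folklore] -/
theorem coeff_pow_eq_zero_below (ω : (Fin 2 →₀ ℕ) → ℤ) (hadd : ∀ p q, ω (p + q) = ω p + ω q)
    (hpos : ∀ p, p ≠ 0 → 1 ≤ ω p) (h : MvPolynomial (Fin 2) ℂ) (h0 : coeff 0 h = 0) (R : ℕ)
    (p : Fin 2 →₀ ℕ) (hp : ω p < (R : ℤ)) : coeff p (h ^ R) = 0 := by
  by_contra hne
  exact absurd (le_wt_of_mem_support_pow ω hadd hpos h h0 R p (mem_support_iff.mpr hne))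
    (not_le.mpr hp)

/-- A support point of `A * B` is a support point of `A` or strictly heavier than one. [folklore] -/
theorem exists_support_left_of_mem_support_mul (ω : (Fin 2 →₀ ℕ) → ℤ)
    (hadd : ∀ p q, ω (p + q) = ω p + ω q) (hpos : ∀ p, p ≠ 0 → 1 ≤ ω p)
    (A B : MvPolynomial (Fin 2) ℂ) (p : Fin 2 →₀ ℕ) (hp : p ∈ (A * B).support) :
    ∃ q ∈ A.support, ω q < ω p ∨ q = p := by
  obtain ⟨a, ha, b, hb, rfl⟩ := Finset.mem_add.mp (support_mul _ _ hp)
  refine ⟨a, ha, ?_⟩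
  by_cases hb0 : b = 0
  · exact Or.inr (by rw [hb0, add_zero])
  · exact Or.inl (by rw [hadd]; linarith [hpos b hb0])

/-- At an exponent not heavier than any support point of `A`, the coefficient of `A * B` is
`coeff p A * coeff 0 B`. [folklore] -/
theorem coeff_mul_of_isMin (ω : (Fin 2 →₀ ℕ) → ℤ) (hadd : ∀ p q, ω (p + q) = ω p + ω q)
    (hpos : ∀ p, p ≠ 0 → 1 ≤ ω p) (A B : MvPolynomial (Fin 2) ℂ) (p : Fin 2 →₀ ℕ)
    (hmin : ∀ q ∈ A.support, ω p ≤ ω q) : coeff p (A * B) = coeff p A * coeff 0 B := by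
  rw [coeff_mul, Finset.sum_eq_single_of_mem (p, 0) (by simp)]
  rintro ⟨a, b⟩ hx hne
  have hx' : a + b = p := Finset.HasAntidiagonal.mem_antidiagonal.mp hx
  have hb0 : b ≠ 0 := by rintro rfl; rw [add_zero] at hx'; exact hne (by rw [hx'])
  have ha : coeff a A = 0 := by
    by_contra hne'
    have := hmin a (mem_support_iff.mpr hne')
    rw [← hx', hadd] at this
    linarith [hpos b hb0]
  rw [ha, zero_mul]

/-- The support of an Euler-type image `T` of `A` lies in the support of `A`. [folklore] -/
theorem mem_support_of_mem_support_euler (ω : (Fin 2 →₀ ℕ) → ℤ) (A T : MvPolynomial (Fin 2) ℂ)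
    (hT : ∀ q, coeff q T = (ω q : ℂ) * coeff q A) {q : Fin 2 →₀ ℕ} (hq : q ∈ T.support) :
    q ∈ A.support := by
  rw [mem_support_iff] at hq ⊢
  exact right_ne_zero_of_mul (hT q ▸ hq)

/-- Abstract transfer of "`e` is the unique lightest support point" from `A` to `C`: every support
point of `C` is a support point of `A` or strictly heavier than one, and every lightest support
point of `A` is a support point of `C`. [folklore] -/
theorem strictMin_transfer (ω : (Fin 2 →₀ ℕ) → ℤ) (A C : MvPolynomial (Fin 2) ℂ)
    (h1 : ∀ p ∈ C.support, ∃ q ∈ A.support, ω q < ω p ∨ q = p)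
    (h2 : ∀ p ∈ A.support, (∀ q ∈ A.support, ω p ≤ ω q) → p ∈ C.support) (e : Fin 2 →₀ ℕ) :
    (e ∈ C.support ∧ ∀ e' ∈ C.support, e' ≠ e → ω e < ω e') ↔
      (e ∈ A.support ∧ ∀ e' ∈ A.support, e' ≠ e → ω e < ω e') := by
  constructor
  · rintro ⟨he, hmin⟩
    obtain ⟨q₀, hq₀, -⟩ := h1 e he
    obtain ⟨p₀, hp₀, hp₀min⟩ := Finset.exists_min_image A.support ω ⟨q₀, hq₀⟩
    have hp₀C : p₀ ∈ C.support := h2 p₀ hp₀ hp₀min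
    have he0 : e = p₀ := by
      by_contra hne
      have hlt : ω e < ω p₀ := hmin p₀ hp₀C (Ne.symm hne)
      obtain ⟨q, hq, hq'⟩ := h1 e he
      rcases hq' with hlt' | rfl <;> linarith [hp₀min _ hq]
    subst he0
    refine ⟨hp₀, fun e' he' hne => ?_⟩
    exact (hp₀min e' he').lt_or_eq.elim id fun heq =>
      hmin e' (h2 e' he' fun q hq => heq ▸ hp₀min q hq) hne
  · rintro ⟨he, hmin⟩
    have heC : e ∈ C.support :=
      h2 e he fun q hq => (eq_or_ne q e).elim (fun h => h ▸ le_rfl) fun h => (hmin q hq h).le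
    refine ⟨heC, fun e' he' hne => ?_⟩
    obtain ⟨q, hq, hq'⟩ := h1 e' he'
    rcases hq' with hlt | rfl
    · exact (eq_or_ne q e).elim (fun hqe => hqe ▸ hlt) fun hqe => lt_trans (hmin q hq hqe) hlt
    · exact hmin _ hq hne

/-- For `A` constant-free with Euler-type image `T`, and `B` with constant term `1`: `e` is the
unique lightest support point of `T * B` iff it is for `A`. [folklore] -/
theorem strictMin_euler_mul_iff (ω : (Fin 2 →₀ ℕ) → ℤ) (hadd : ∀ p q, ω (p + q) = ω p + ω q)
    (hpos : ∀ p, p ≠ 0 → 1 ≤ ω p) (A T B : MvPolynomial (Fin 2) ℂ)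
    (hT : ∀ q, coeff q T = (ω q : ℂ) * coeff q A) (hA : coeff 0 A = 0) (hB : coeff 0 B = 1)
    (e : Fin 2 →₀ ℕ) :
    (e ∈ (T * B).support ∧ ∀ e' ∈ (T * B).support, e' ≠ e → ω e < ω e') ↔
      (e ∈ A.support ∧ ∀ e' ∈ A.support, e' ≠ e → ω e < ω e') := by
  refine strictMin_transfer ω A (T * B) (fun p hp => ?_) (fun p hp hmin => ?_) e
  · obtain ⟨q, hq, hq'⟩ := exists_support_left_of_mem_support_mul ω hadd hpos T B p hp
    exact ⟨q, mem_support_of_mem_support_euler ω A T hT hq, hq'⟩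
  · have hp0 : p ≠ 0 := by rintro rfl; exact (mem_support_iff.mp hp) hA
    rw [mem_support_iff, coeff_mul_of_isMin ω hadd hpos T B p
      (fun q hq => hmin q (mem_support_of_mem_support_euler ω A T hT hq)), hB, mul_one, hT]
    exact mul_ne_zero (Int.cast_ne_zero.mpr (by linarith [hpos p hp0])) (mem_support_iff.mp hp)

/-- Congruence below `N` transports "`e` is the unique lightest support point" when `ω e < N`.
[folklore] -/
theorem strictMin_of_congr_below (ω : (Fin 2 →₀ ℕ) → ℤ) (A B : MvPolynomial (Fin 2) ℂ) (N : ℤ)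
    (hAB : ∀ p, ω p < N → coeff p A = coeff p B) (e : Fin 2 →₀ ℕ) (he : ω e < N)
    (h : e ∈ A.support ∧ ∀ e' ∈ A.support, e' ≠ e → ω e < ω e') :
    e ∈ B.support ∧ ∀ e' ∈ B.support, e' ≠ e → ω e < ω e' := by
  obtain ⟨heA, hmin⟩ := h
  refine ⟨?_, fun e' he' hne => ?_⟩
  · rw [mem_support_iff, ← hAB e he]
    exact mem_support_iff.mp heA
  · by_cases h' : ω e' < N
    · refine hmin e' ?_ hne
      rw [mem_support_iff, hAB e' h']
      exact mem_support_iff.mp he'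
    · linarith

/-- For `H` constant-free, `Q` with constant term `1` and Euler-type images `TH`, `TQ`:
`e` is the unique lightest support point of `TH * Q - H * TQ` iff it is for `H`. [folklore] -/
theorem strictMin_wronskian_iff (ω : (Fin 2 →₀ ℕ) → ℤ) (hadd : ∀ p q, ω (p + q) = ω p + ω q)
    (hpos : ∀ p, p ≠ 0 → 1 ≤ ω p) (H Q TH TQ : MvPolynomial (Fin 2) ℂ)
    (hTH : ∀ q, coeff q TH = (ω q : ℂ) * coeff q H) (hTQ : ∀ q, coeff q TQ = (ω q : ℂ) * coeff q Q)
    (hH : coeff 0 H = 0) (hQ : coeff 0 Q = 1) (e : Fin 2 →₀ ℕ) :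
    (e ∈ (TH * Q - H * TQ).support ∧ ∀ e' ∈ (TH * Q - H * TQ).support, e' ≠ e → ω e < ω e') ↔
      (e ∈ H.support ∧ ∀ e' ∈ H.support, e' ≠ e → ω e < ω e') := by
  refine strictMin_transfer ω H (TH * Q - H * TQ) (fun p hp => ?_) (fun p hp hmin => ?_) e
  · rcases Finset.mem_union.mp (support_sub _ _ _ hp) with hp1 | hp2
    · obtain ⟨q, hq, hq'⟩ := exists_support_left_of_mem_support_mul ω hadd hpos TH Q p hp1
      exact ⟨q, mem_support_of_mem_support_euler ω H TH hTH hq, hq'⟩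
    · exact exists_support_left_of_mem_support_mul ω hadd hpos H TQ p hp2
  · have hp0 : p ≠ 0 := by rintro rfl; exact (mem_support_iff.mp hp) hH
    rw [mem_support_iff, coeff_sub, coeff_mul_of_isMin ω hadd hpos TH Q p
      (fun q hq => hmin q (mem_support_of_mem_support_euler ω H TH hTH hq)),
      coeff_mul_of_isMin ω hadd hpos H TQ p hmin, hTQ 0, wt_zero ω hadd, hQ, hTH, mul_one,
      Int.cast_zero, zero_mul, mul_zero, sub_zero]
    exact mul_ne_zero (Int.cast_ne_zero.mpr (by linarith [hpos p hp0])) (mem_support_iff.mp hp)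

/-- Exact derivative of the truncated logarithm: for any derivation `D`,
`D (∑_{s=1}^{R} ((-1)^(s+1)/s) • (u-1)^s) = D u * ∑_{t<R} (1-u)^t`. [folklore] -/
theorem deriv_logTrunc (D : Derivation ℂ (MvPolynomial (Fin 2) ℂ) (MvPolynomial (Fin 2) ℂ))
    (u : MvPolynomial (Fin 2) ℂ) (R : ℕ) :
    D (∑ s ∈ Finset.Icc 1 R, ((-1 : ℂ) ^ (s + 1) / (s : ℂ)) • (u - 1) ^ s) =
      D u * ∑ t ∈ Finset.range R, (1 - u) ^ t := by
  induction R with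
  | zero => simp
  | succ R ih =>
    rw [Finset.sum_Icc_succ_top (by omega), map_add, ih, Finset.sum_range_succ, mul_add]
    congr 1
    rw [D.map_smul, D.leibniz_pow, Nat.add_sub_cancel, map_sub, D.map_one_eq_zero, sub_zero,
      smul_eq_mul, ← Nat.cast_smul_eq_nsmul ℂ, smul_smul,
      div_mul_cancel₀ _ (Nat.cast_ne_zero.mpr (Nat.succ_ne_zero R)),
      MvPolynomial.smul_eq_C_mul, map_pow, map_neg, map_one,
      show ((1 : MvPolynomial (Fin 2) ℂ) - u) ^ R = (-1) ^ R * (u - 1) ^ R by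
        rw [← neg_pow, neg_sub]]
    ring

/-- For `u` with constant term `1`: `u * D (log_R u) ≡ D u` below weight `R`. [folklore] -/
theorem coeff_mul_deriv_logTrunc (ω : (Fin 2 →₀ ℕ) → ℤ) (hadd : ∀ p q, ω (p + q) = ω p + ω q)
    (hpos : ∀ p, p ≠ 0 → 1 ≤ ω p)
    (D : Derivation ℂ (MvPolynomial (Fin 2) ℂ) (MvPolynomial (Fin 2) ℂ))
    (u : MvPolynomial (Fin 2) ℂ) (hu : coeff 0 u = 1) (R : ℕ) :
    ∀ p, ω p < (R : ℤ) →
      coeff p (u * D (∑ s ∈ Finset.Icc 1 R, ((-1 : ℂ) ^ (s + 1) / (s : ℂ)) • (u - 1) ^ s)) =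
        coeff p (D u) := by
  intro p hp
  have h0 : coeff 0 (1 - u) = 0 := by rw [coeff_sub, coeff_zero_one, hu, sub_self]
  rw [deriv_logTrunc, mul_left_comm,
    show u * ∑ t ∈ Finset.range R, (1 - u) ^ t = 1 - (1 - u) ^ R by
      rw [← mul_neg_geom_sum, sub_sub_cancel],
    mul_sub, mul_one, coeff_sub,
    coeff_mul_congr_below ω hadd hpos R (D u) (D u) ((1 - u) ^ R) 0 (fun _ _ => rfl)
      (fun q hq => by rw [coeff_zero]; exact coeff_pow_eq_zero_below ω hadd hpos _ h0 R q hq) p hp,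
    mul_zero, coeff_zero, sub_zero]

/-- For factors with constant term `1`: `(∏ u_i) * D (∑_r c_r • ∑_i (u_i-1)^r) ≡ D (∏ u_i)` below
weight `R`. [folklore] -/
theorem coeff_prod_mul_deriv_logTrunc (ω : (Fin 2 →₀ ℕ) → ℤ)
    (hadd : ∀ p q, ω (p + q) = ω p + ω q) (hpos : ∀ p, p ≠ 0 → 1 ≤ ω p)
    (D : Derivation ℂ (MvPolynomial (Fin 2) ℂ) (MvPolynomial (Fin 2) ℂ)) {n : ℕ}
    (u : Fin n → MvPolynomial (Fin 2) ℂ) (hu : ∀ i, coeff 0 (u i) = 1) (R : ℕ)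
    (s : Finset (Fin n)) :
    ∀ p, ω p < (R : ℤ) →
      coeff p ((∏ i ∈ s, u i) *
          D (∑ r ∈ Finset.Icc 1 R, ((-1 : ℂ) ^ (r + 1) / (r : ℂ)) • ∑ i ∈ s, (u i - 1) ^ r)) =
        coeff p (D (∏ i ∈ s, u i)) := by
  induction s using Finset.induction_on with
  | empty =>
    intro p _
    simp
  | insert a s ha ih =>
    intro p hp
    simp only [Finset.prod_insert ha, Finset.sum_insert ha, smul_add, Finset.sum_add_distrib,
      map_add, D.leibniz, smul_eq_mul]
    rw [show ∀ X Y : MvPolynomial (Fin 2) ℂ, u a * (∏ i ∈ s, u i) * (X + Y) =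
        u a * ((∏ i ∈ s, u i) * Y) + (∏ i ∈ s, u i) * (u a * X) from fun X Y => by ring,
      coeff_add, coeff_add,
      coeff_mul_congr_below ω hadd hpos R (u a) (u a) _ _ (fun _ _ => rfl) ih p hp,
      coeff_mul_congr_below ω hadd hpos R (∏ i ∈ s, u i) (∏ i ∈ s, u i) _ _ (fun _ _ => rfl)
        (coeff_mul_deriv_logTrunc ω hadd hpos D (u a) (hu a) R) p hp]

/-- `D (P - Q) * Q - (P - Q) * D Q ≡ P * Q * D Λ_R` below weight `R`. [folklore] -/
theorem coeff_wronskian_congr (ω : (Fin 2 →₀ ℕ) → ℤ) (hadd : ∀ p q, ω (p + q) = ω p + ω q)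
    (hpos : ∀ p, p ≠ 0 → 1 ≤ ω p)
    (D : Derivation ℂ (MvPolynomial (Fin 2) ℂ) (MvPolynomial (Fin 2) ℂ)) {n : ℕ}
    (u v : Fin n → MvPolynomial (Fin 2) ℂ) (hu : ∀ i, coeff 0 (u i) = 1)
    (hv : ∀ i, coeff 0 (v i) = 1) (R : ℕ) :
    ∀ p, ω p < (R : ℤ) →
      coeff p (D (∏ i, u i - ∏ i, v i) * (∏ i, v i) - (∏ i, u i - ∏ i, v i) * D (∏ i, v i)) =
        coeff p ((∏ i, u i) * (∏ i, v i) *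
          D (∑ r ∈ Finset.Icc 1 R, ((-1 : ℂ) ^ (r + 1) / (r : ℂ)) •
            (∑ i, (u i - 1) ^ r - ∑ i, (v i - 1) ^ r))) := by
  intro p hp
  simp only [smul_sub, Finset.sum_sub_distrib, map_sub]
  rw [show ∀ A B X Y : MvPolynomial (Fin 2) ℂ, A * B * (X - Y) = B * (A * X) - A * (B * Y) from
      fun _ _ _ _ => by ring,
    show ∀ A B A' B' : MvPolynomial (Fin 2) ℂ, (A' - B') * B - (A - B) * B' = B * A' - A * B' from
      fun _ _ _ _ => by ring,
    coeff_sub, coeff_sub,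
    coeff_mul_congr_below ω hadd hpos R (∏ i, v i) (∏ i, v i) _ _ (fun _ _ => rfl)
      (coeff_prod_mul_deriv_logTrunc ω hadd hpos D u hu R Finset.univ) p hp,
    coeff_mul_congr_below ω hadd hpos R (∏ i, u i) (∏ i, u i) _ _ (fun _ _ => rfl)
      (coeff_prod_mul_deriv_logTrunc ω hadd hpos D v hv R Finset.univ) p hp]

/-- Abstract chain: if `P`, `Q` have constant term `1`, `Λ` is constant-free, and
`D (P - Q) * Q - (P - Q) * D Q ≡ P * Q * D Λ` below `R` for an Euler-type derivation `D`, then for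
`ω e < R`: `e` is the unique lightest support point of `P - Q` iff it is for `Λ`. [folklore] -/
theorem strictMin_sub_iff_of_congr (ω : (Fin 2 →₀ ℕ) → ℤ) (hadd : ∀ p q, ω (p + q) = ω p + ω q)
    (hpos : ∀ p, p ≠ 0 → 1 ≤ ω p)
    (D : Derivation ℂ (MvPolynomial (Fin 2) ℂ) (MvPolynomial (Fin 2) ℂ))
    (hD : ∀ A q, coeff q (D A) = (ω q : ℂ) * coeff q A) (P Q Λ : MvPolynomial (Fin 2) ℂ)
    (hP : coeff 0 P = 1) (hQ : coeff 0 Q = 1) (hΛ : coeff 0 Λ = 0) (R : ℕ)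
    (hcong : ∀ p, ω p < (R : ℤ) → coeff p (D (P - Q) * Q - (P - Q) * D Q) = coeff p (P * Q * D Λ))
    (e : Fin 2 →₀ ℕ) (he : ω e < (R : ℤ)) :
    (e ∈ (P - Q).support ∧ ∀ e' ∈ (P - Q).support, e' ≠ e → ω e < ω e') ↔
      (e ∈ Λ.support ∧ ∀ e' ∈ Λ.support, e' ≠ e → ω e < ω e') := by
  have hPQ : coeff 0 (P - Q) = 0 := by rw [coeff_sub, hP, hQ, sub_self]
  have hPQ1 : coeff 0 (P * Q) = 1 := by
    rw [coeff_mul_of_isMin ω hadd hpos P Q 0 (fun q _ => ?_), hP, hQ, mul_one]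
    rw [wt_zero ω hadd]
    exact wt_nonneg ω hadd hpos q
  refine (strictMin_wronskian_iff ω hadd hpos (P - Q) Q (D (P - Q)) (D Q) (hD _) (hD _) hPQ hQ
    e).symm.trans ?_
  refine ⟨fun h => ?_, fun h => ?_⟩
  · have h' := strictMin_of_congr_below ω _ _ (R : ℤ) hcong e he h
    rw [mul_comm (P * Q) (D Λ)] at h'
    exact (strictMin_euler_mul_iff ω hadd hpos Λ (D Λ) (P * Q) (hD Λ) hΛ hPQ1 e).mp h'
  · refine strictMin_of_congr_below ω _ _ (R : ℤ) (fun p hp => (hcong p hp).symm) e he ?_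
    rw [mul_comm (P * Q) (D Λ)]
    exact (strictMin_euler_mul_iff ω hadd hpos Λ (D Λ) (P * Q) (hD Λ) hΛ hPQ1 e).mpr h

/-- One summand of the Euler derivation on a monomial. [folklore] -/
theorem monomial_tsub_smul_wX (w : Fin 2 → ℤ) (s : Fin 2 →₀ ℕ) (i : Fin 2) :
    (monomial (s - Finsupp.single i 1) ((s i : ℕ) : ℂ) : MvPolynomial (Fin 2) ℂ) •
        (((w i : ℤ) : ℂ) • (X i : MvPolynomial (Fin 2) ℂ)) =
      (((w i : ℤ) : ℂ) * ((s i : ℕ) : ℂ)) • monomial s (1 : ℂ) := by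
  rw [smul_eq_mul, mul_smul_comm, mul_smul]
  congr 1
  by_cases h : s i = 0
  · simp [h]
  · rw [X, monomial_mul, mul_one,
      tsub_add_cancel_of_le (Finsupp.single_le_iff.mpr (Nat.one_le_iff_ne_zero.mpr h)),
      smul_monomial, smul_eq_mul, mul_one]

/-- Coefficient formula for the Euler derivation `θ_w = ∑ i, w i • X i ∂_i`:
`coeff q (θ_w A) = (w 0 * q 0 + w 1 * q 1) * coeff q A`. [folklore] -/
theorem coeff_eulerDerivation (w : Fin 2 → ℤ) (A : MvPolynomial (Fin 2) ℂ) (q : Fin 2 →₀ ℕ) :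
    coeff q (MvPolynomial.mkDerivation ℂ
        (fun i : Fin 2 => ((w i : ℤ) : ℂ) • (X i : MvPolynomial (Fin 2) ℂ)) A) =
      ((w 0 * (q 0 : ℤ) + w 1 * (q 1 : ℤ) : ℤ) : ℂ) * coeff q A := by
  induction A using MvPolynomial.induction_on' with
  | monomial s a =>
    rw [MvPolynomial.mkDerivation_monomial, Finsupp.sum_fintype _ _ (fun i => by simp),
      Fin.sum_univ_two, monomial_tsub_smul_wX, monomial_tsub_smul_wX, ← add_smul, smul_smul,
      coeff_smul, coeff_monomial, coeff_monomial]
    split_ifs with h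
    · subst h
      push_cast
      rw [smul_eq_mul]
      ring
    · rw [smul_zero, mul_zero]
  | add p q hp hq => rw [map_add, coeff_add, coeff_add, hp, hq, mul_add]

/-- The weight `p ↦ w 0 * p 0 + w 1 * p 1` with `w 0, w 1 ≥ 1` is `≥ 1` on nonzero exponents.
[folklore] -/
theorem one_le_wt_of_ne_zero (w : Fin 2 → ℤ) (hw0 : 0 < w 0) (hw1 : 0 < w 1) (p : Fin 2 →₀ ℕ)
    (hp : p ≠ 0) : 1 ≤ w 0 * (p 0 : ℤ) + w 1 * (p 1 : ℤ) := by
  have h : p 0 ≠ 0 ∨ p 1 ≠ 0 := by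
    by_contra h
    push Not at h
    exact hp (by ext i; fin_cases i <;> simp [h.1, h.2])
  have h0 : (0 : ℤ) ≤ (p 0 : ℤ) := Nat.cast_nonneg _
  have h1 : (0 : ℤ) ≤ (p 1 : ℤ) := Nat.cast_nonneg _
  rcases h with h | h
  · have h' : (1 : ℤ) ≤ (p 0 : ℤ) := by exact_mod_cast Nat.one_le_iff_ne_zero.mpr h
    nlinarith
  · have h' : (1 : ℤ) ≤ (p 1 : ℤ) := by exact_mod_cast Nat.one_le_iff_ne_zero.mpr h
    nlinarith

/-- Constant term of a product of polynomials with constant term `1`. [folklore] -/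
theorem coeff_zero_prod_eq_one {n : ℕ} (u : Fin n → MvPolynomial (Fin 2) ℂ)
    (hu : ∀ i, coeff 0 (u i) = 1) : coeff 0 (∏ i, u i) = 1 := by
  rw [← constantCoeff_eq, map_prod]
  exact Finset.prod_eq_one fun i _ => by rw [constantCoeff_eq]; exact hu i

/-- The truncated log-difference is constant-free. [folklore] -/
theorem coeff_zero_logTrunc {n : ℕ} (u v : Fin n → MvPolynomial (Fin 2) ℂ)
    (hu : ∀ i, coeff 0 (u i) = 1) (hv : ∀ i, coeff 0 (v i) = 1) (R : ℕ) :
    coeff 0 (∑ r ∈ Finset.Icc 1 R, ((-1 : ℂ) ^ (r + 1) / (r : ℂ)) •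
        (∑ i, (u i - 1) ^ r - ∑ i, (v i - 1) ^ r)) = 0 := by
  have hu' : ∀ i, constantCoeff (u i) = 1 := fun i => by rw [constantCoeff_eq]; exact hu i
  have hv' : ∀ i, constantCoeff (v i) = 1 := fun i => by rw [constantCoeff_eq]; exact hv i
  rw [← constantCoeff_eq, map_sum]
  refine Finset.sum_eq_zero fun r _ => ?_
  rw [constantCoeff_smul, map_sub, map_sum, map_sum]
  simp [hu', hv']

/-- **Power-sum criterion** (log-linearisation at finite order): for `ω e < R`, the exponent
`e` is the unique `ω`-lightest support point of `∏ u_i - ∏ v_i` iff it is the unique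
`ω`-lightest support point of the order-`R` truncation of `∑ log u_i - ∑ log v_i`. [folklore] -/
theorem stub_powerSumCriterion : ∀ (n : ℕ) (u v : Fin n → MvPolynomial (Fin 2) ℂ),
    (∀ i, MvPolynomial.coeff 0 (u i) = 1) → (∀ i, MvPolynomial.coeff 0 (v i) = 1) →
    ∀ (w : Fin 2 → ℤ), 0 < w 0 → 0 < w 1 →
    ∀ (e : Fin 2 →₀ ℕ) (R : ℕ), w 0 * (e 0 : ℤ) + w 1 * (e 1 : ℤ) < (R : ℤ) →
      ((e ∈ (∏ i, u i - ∏ i, v i).support ∧ ∀ e' ∈ (∏ i, u i - ∏ i, v i).support, e' ≠ e →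
          w 0 * (e 0 : ℤ) + w 1 * (e 1 : ℤ) < w 0 * (e' 0 : ℤ) + w 1 * (e' 1 : ℤ)) ↔
        (e ∈ (∑ r ∈ Finset.Icc 1 R, ((-1 : ℂ) ^ (r + 1) / (r : ℂ)) •
              (∑ i, (u i - 1) ^ r - ∑ i, (v i - 1) ^ r)).support ∧
          ∀ e' ∈ (∑ r ∈ Finset.Icc 1 R, ((-1 : ℂ) ^ (r + 1) / (r : ℂ)) •
              (∑ i, (u i - 1) ^ r - ∑ i, (v i - 1) ^ r)).support, e' ≠ e →
            w 0 * (e 0 : ℤ) + w 1 * (e 1 : ℤ) < w 0 * (e' 0 : ℤ) + w 1 * (e' 1 : ℤ))) := by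
  intro n u v hu hv w hw0 hw1 e R heR
  have hadd : ∀ p q : Fin 2 →₀ ℕ,
      w 0 * ((p + q) 0 : ℤ) + w 1 * ((p + q) 1 : ℤ) =
        (w 0 * (p 0 : ℤ) + w 1 * (p 1 : ℤ)) + (w 0 * (q 0 : ℤ) + w 1 * (q 1 : ℤ)) := by
    intro p q
    simp only [Finsupp.coe_add, Pi.add_apply]
    push_cast
    ring
  exact strictMin_sub_iff_of_congr (fun p : Fin 2 →₀ ℕ => w 0 * (p 0 : ℤ) + w 1 * (p 1 : ℤ))
    hadd (one_le_wt_of_ne_zero w hw0 hw1)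
    (MvPolynomial.mkDerivation ℂ fun i : Fin 2 => ((w i : ℤ) : ℂ) • (X i : MvPolynomial (Fin 2) ℂ))
    (coeff_eulerDerivation w) (∏ i, u i) (∏ i, v i) _ (coeff_zero_prod_eq_one u hu)
    (coeff_zero_prod_eq_one v hv) (coeff_zero_logTrunc u v hu hv R) R
    (coeff_wronskian_congr _ hadd (one_le_wt_of_ne_zero w hw0 hw1) _ u v hu hv R) e heR

end Summit.ValiantsHypothesis.ValiantsHypothesis.Theorems.TwoProducts.PowerSum
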